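import Literature.MathematicalPhysics.QuantumFieldTheory.Balaban1983to89.Node00.Record13NumericsOfThm1CC1

/-!
# NODE 00 (YM-PLAN Track A) — STAGE 13: PARTITION COMPATIBILITY (C2) IS A SIZE CONDITION WHEN THE BASIC CUBE IS A POWER OF `L` —
# `PartCompat₁₃ θ p n ↔ ∀ 1 ≤ j ≤ n, L^j·M·R_j ≤ 2·L^{m+K}` at `θ.τ9.M = L^a` (director-ym LINE №145 (F1)∕tribunal-J field `hM`; the M4-dodge located by vet-20289),
# and the discharge at `θ₁₅ᶜᶜ¹` (`M = 1 = L⁰`)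

Cell `pub-ymgap`, seat `pub-ymgap-node00-def-K0a` (g6), FILE 13f.  [III] = [Balaban1988Convergent], [I] = [Balaban1987RG1].

WHY.  Row P11's run antecedent `PartCompat₁₃ θ p n` asks `L^j·M·R_j ∣ 2·L^{m+K}` (𝐃_j-cube side divides the torus period, [III] p. 257 «all partitions are
compatible»), `1 ≤ j ≤ n`.  vet-20289 located the dodge `4 ∣ M` (no positive-length run is compatible, the row is vacuous); director-ym №145 rules the cure INTO
node00-def-T's `Record13` v1.3 as FIELDS: `hM : ∃ a, θ.τ9.M = F.L ^ a` ([III] p. 245 «M = L^m») and an OBLIGATION `c2 : ‹run of positive length› → PartCompat₁₃ θ p n`.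
This file records the arithmetic that makes `c2` DISCHARGEABLE and says what its premise must carry: `R_j = RkOfRecord L r g_j` is a power of `L` BY DEFINITION
((2.5): the least `L^s ≥ (log g_j⁻²)^r`, junk branch `1 = L⁰`), so at `M = L^a` the cube side is `L^{j+a+s_j}` and, `L` being odd `≥ 3`, DIVISIBILITY of `2·L^{m+K}` IS the
SIZE bound `L^{j+a+s_j} ≤ 2·L^{m+K}` (⟺ `j + a + s_j ≤ m + K`).  A premise «history in the window up to `n ≥ 1`» alone does NOT give it (at fixed `(m, K)` a run with
`g₀ → 0` has `R_1 → ∞`), so a `c2` keyed on the window only would be false at EVERY θ; keyed on the size of the 𝐃_j-cubes it is a theorem at every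
power-of-`L` basic cube — in particular at all K0a witnesses (`M = 1`).

WHAT THIS FILE PROVES (theorems only; 0 `def`).
* §1 arithmetic: `pow_dvd_two_mul_pow_of_le` (`3 ≤ L`, `L^e ≤ 2·L^f ⇒ L^e ∣ 2·L^f`), `exists_RkOfRecord_eq_pow` (`R = L^s`), `exists_dCubeSide_eq_pow` (`M = L^a ⇒ side = L^e`).
* §2 ★ `Stage13Params.partCompat₁₃_of_dCubeSide_le (hM : ∃ a, θ.τ9.M = F.L ^ a) (hsz : ∀ j, 1 ≤ j → j ≤ n → dCubeSide … j ≤ (F.P p.K).sitesPerDir 0) : PartCompat₁₃ F N θ p n`,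
  `Stage13Params.dCubeSide_le_of_partCompat₁₃` (converse, any `M`), ★ `Stage13Params.partCompat₁₃_iff_dCubeSide_le (hM)`.
* §3 at `θ₁₅ᶜᶜ¹`: `theta13OfThm1CC1_M_eq_pow : ∃ a, θ₁₅ᶜᶜ¹.τ9.M = F.L ^ a` (`⟨0, rfl⟩`), ★ `partCompat₁₃_theta13OfThm1CC1_of_dCubeSide_le`.

HONEST FRAMING.  Elementary arithmetic on the record's definitions; nothing of Bałaban asserted; NOT a discharge; counts unmoved (typed 28∕28 · discharged 5∕28); one finite 𝕋⁴
programme at fixed ε — NOT continuum ∕ OS ∕ mass gap ∕ Clay.  No `sorry`, `axiom`, `def`, `instance`, `notation`.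
-/

noncomputable section

namespace Literature.MathematicalPhysics.QuantumFieldTheory.Balaban1983to89.Node00

open T4Continuum

/-! ## §1. Arithmetic: powers of an odd `L ≥ 3` against the torus period `2·L^f` -/

section Arith

/-- For `3 ≤ L`: `L^e ≤ 2·L^f ⇒ e ≤ f` (`L^{f+1} = L·L^f ≥ 3·L^f > 2·L^f`). [cite: Balaban1987RG1, (0.1) p.251 (elementary)] -/
theorem le_of_pow_le_two_mul_pow {L e f : ℕ} (hL : 3 ≤ L) (h : L ^ e ≤ 2 * L ^ f) : e ≤ f := by
  by_contra hef
  have hf1 : f + 1 ≤ e := by omega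
  have h1 : L ^ (f + 1) ≤ L ^ e := Nat.pow_le_pow_right (by omega) hf1
  have h2 : L ^ (f + 1) = L * L ^ f := by ring
  have h3 : 0 < L ^ f := Nat.pow_pos (by omega)
  nlinarith

/-- For `3 ≤ L`: `L^e ≤ 2·L^f ⇒ L^e ∣ 2·L^f`. [cite: Balaban1987RG1, (0.1) p.251 (elementary)] -/
theorem pow_dvd_two_mul_pow_of_le {L e f : ℕ} (hL : 3 ≤ L) (h : L ^ e ≤ 2 * L ^ f) : L ^ e ∣ 2 * L ^ f :=
  (pow_dvd_pow L (le_of_pow_le_two_mul_pow hL h)).trans (dvd_mul_left _ _)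

/-- **The cube factor of (2.5) is a power of `L`** (by definition: the least `L^s ≥ (log g⁻²)^r`, junk branch `1 = L⁰`). [cite: Balaban1988Convergent, (2.5) p.255 (bookkeeping)] -/
theorem exists_RkOfRecord_eq_pow (L r : ℕ) (g : ℝ) : ∃ s : ℕ, RkOfRecord L r g = L ^ s := by
  unfold RkOfRecord
  split
  · exact ⟨_, rfl⟩
  · exact ⟨0, (pow_zero L).symm⟩

/-- **At a power-of-`L` basic cube the 𝐃_j-cube side is a power of `L`**: `L^j·L^a·L^s = L^{j+a+s}`. [cite: Balaban1988Convergent, (2.1) p.254, (2.5) p.255 (bookkeeping)] -/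
theorem exists_dCubeSide_eq_pow {L M a : ℕ} (hM : M = L ^ a) (r : ℕ) (g : ℝ) (j : ℕ) : ∃ e : ℕ, dCubeSide L M (RkOfRecord L r g) j = L ^ e := by
  obtain ⟨s, hs⟩ := exists_RkOfRecord_eq_pow L r g
  exact ⟨j + a + s, by rw [dCubeSide, hM, hs, pow_add, pow_add]⟩

end Arith

/-! ## §2. ★ `PartCompat₁₃` at a power-of-`L` basic cube IS the size bound on the 𝐃_j-cubes -/

section Generic

variable {F : T4Family} {N : ℕ} [NeZero N]

/-- **★ (C2) FROM SIZE at `M = L^a`**: if every 𝐃_j-cube side `L^j·M·R_j(g_j)` along the run up to `n` is at most the torus period `2·L^{m+K}` (fine sites), the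
partitions are compatible (`∣`).  The form in which node00-def-T's v1.3 obligation `c2` (director-ym №145 (F1)) is dischargeable — its premise must bound the cubes, not
only the history. [cite: Balaban1988Convergent, (2.1) p.254, (2.5) p.255, p.257; Balaban1987RG1, (0.1) p.251] -/
theorem Stage13Params.partCompat₁₃_of_dCubeSide_le (θ : Stage13Params F N) (hM : ∃ a : ℕ, θ.τ9.M = F.L ^ a) (p : B12.RunParams) (n : ℕ)
    (hsz : ∀ j, 1 ≤ j → j ≤ n →
      dCubeSide (F.P p.K).L θ.τ9.M (RkOfRecord (F.P p.K).L θ.ν.r (gOfRecord₁₃ F N θ p j)) j ≤ (F.P p.K).sitesPerDir 0) :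
    PartCompat₁₃ F N θ p n := by
  intro j h1 hj
  obtain ⟨a, ha⟩ := hM
  obtain ⟨e, he⟩ := exists_dCubeSide_eq_pow (L := (F.P p.K).L) ha θ.ν.r (gOfRecord₁₃ F N θ p j) j
  have h := hsz j h1 hj
  rw [he] at h ⊢
  have hL : 3 ≤ (F.P p.K).L := by show 3 ≤ F.L; have := F.hL11; omega
  exact pow_dvd_two_mul_pow_of_le hL h

/-- **Compatibility ⇒ size** (any `M`): a divisor of the (positive) torus period is at most the period. [cite: Balaban1988Convergent, p.257 (bookkeeping)] -/
theorem Stage13Params.dCubeSide_le_of_partCompat₁₃ (θ : Stage13Params F N) (p : B12.RunParams) (n : ℕ) (h : PartCompat₁₃ F N θ p n) :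
    ∀ j, 1 ≤ j → j ≤ n →
      dCubeSide (F.P p.K).L θ.τ9.M (RkOfRecord (F.P p.K).L θ.ν.r (gOfRecord₁₃ F N θ p j)) j ≤ (F.P p.K).sitesPerDir 0 :=
  fun j h1 hj => Nat.le_of_dvd (by show 0 < 2 * F.L ^ (F.m + p.K - 0); have := F.hL11; positivity) (h j h1 hj)

/-- **★ (C2) ⟺ SIZE at a power-of-`L` basic cube.** [cite: Balaban1988Convergent, (2.1) p.254, (2.5) p.255, p.257; Balaban1987RG1, (0.1) p.251] -/
theorem Stage13Params.partCompat₁₃_iff_dCubeSide_le (θ : Stage13Params F N) (hM : ∃ a : ℕ, θ.τ9.M = F.L ^ a) (p : B12.RunParams) (n : ℕ) :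
    PartCompat₁₃ F N θ p n ↔
      ∀ j, 1 ≤ j → j ≤ n →
        dCubeSide (F.P p.K).L θ.τ9.M (RkOfRecord (F.P p.K).L θ.ν.r (gOfRecord₁₃ F N θ p j)) j ≤ (F.P p.K).sitesPerDir 0 :=
  ⟨θ.dCubeSide_le_of_partCompat₁₃ p n, θ.partCompat₁₃_of_dCubeSide_le hM p n⟩

end Generic

/-! ## §3. At `θ₁₅ᶜᶜ¹`: `M = 1 = L⁰`, so (C2) along any run is the size bound on its 𝐃_j-cubes -/

section AtWitness

variable (F : T4Family) (N : ℕ) [NeZero N] (ε₀ ε₂₉ B₃ B₃' a₀ a₁ : ℝ)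

/-- **The basic cube of `θ₁₅ᶜᶜ¹` is a power of `L`** (`M = 1 = L⁰`; tribunal-J's field `hM` at the witness). [cite: Balaban1988Convergent, p.245 («M = L^m»), (2.1) p.254 (bookkeeping)] -/
theorem theta13OfThm1CC1_M_eq_pow : ∃ a : ℕ, (theta13OfThm1CC1 F N ε₀ ε₂₉ B₃ B₃' a₀ a₁).τ9.M = F.L ^ a :=
  ⟨0, rfl⟩

/-- **★ (C2) AT `θ₁₅ᶜᶜ¹` FROM THE SIZE OF THE 𝐃_j-CUBES** — node00-def-T's v1.3 obligation `c2` at the witness, for every run whose cubes up to `n` fit the torus.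
[cite: Balaban1988Convergent, (2.1) p.254, (2.5) p.255, p.257; Balaban1987RG1, (0.1) p.251] -/
theorem partCompat₁₃_theta13OfThm1CC1_of_dCubeSide_le (p : B12.RunParams) (n : ℕ)
    (hsz : ∀ j, 1 ≤ j → j ≤ n →
      dCubeSide (F.P p.K).L (theta13OfThm1CC1 F N ε₀ ε₂₉ B₃ B₃' a₀ a₁).τ9.M
          (RkOfRecord (F.P p.K).L (theta13OfThm1CC1 F N ε₀ ε₂₉ B₃ B₃' a₀ a₁).ν.r
            (gOfRecord₁₃ F N (theta13OfThm1CC1 F N ε₀ ε₂₉ B₃ B₃' a₀ a₁) p j)) j ≤ (F.P p.K).sitesPerDir 0) :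
    PartCompat₁₃ F N (theta13OfThm1CC1 F N ε₀ ε₂₉ B₃ B₃' a₀ a₁) p n :=
  (theta13OfThm1CC1 F N ε₀ ε₂₉ B₃ B₃' a₀ a₁).partCompat₁₃_of_dCubeSide_le (theta13OfThm1CC1_M_eq_pow F N ε₀ ε₂₉ B₃ B₃' a₀ a₁) p n hsz

end AtWitness

end Literature.MathematicalPhysics.QuantumFieldTheory.Balaban1983to89.Node00

end
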